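import Mathlib
import HarnessLib
import Literature.MathematicalPhysics.QuantumFieldTheory.QCDPhaseQuenched

/-!
# Borel measurability of the spectral index `U ↦ n₋(Γ₅ D_W(U, m₀, 1))` (stub S7)

Line `Sketch` (crux idea `wall-conditioned-cell-spread`) of the restated crux `WindowExtinction`
(stmt-QuantumFields-18063, route `SpectralDefectExtinction`).  Every phase-quenched expectation `E₊`
of the crux is a Bochner integral, over the gauge field `U : GaugeConfig 4 n SU(3)` (product Borel
σ-algebra), of the spectral index `U ↦ n₋(Γ₅ D_W(U, m₀, 1))` — the number of roots `z` with `re z < 0`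
(with algebraic multiplicity, written inline as `Multiset.countP (fun z => z.re < 0)` over the roots of
the characteristic polynomial) of the Hermitian Wilson–Dirac operator.  Without measurability of that
count those integrals are junk; `stub_indexMeasurable` supplies it.

This file RE-LANDS, in a module with healthy imports (Mathlib + `Literature` only), the generic
root-count measurability toolkit of
`Theorems/SpectralDefectExtinctionTipPricingStubCountMeasurable.lean` and its application
`Theorems/SpectralDefectExtinctionWindowExtinctionStubNegCountMeasurable.lean` (both currently import a
source-broken module and do not build); the proofs below are adapted from those files.

Route (`indexMeas_measurable_countP`): for a continuous matrix-valued map `A` on a topological space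
whose σ-algebra contains the open sets and a predicate `P` on `ℂ` whose truth set is an increasing
countable union of CLOSED sets `F j`, the count `x ↦ (charpoly (A x)).roots.countP P` is measurable:

1. `indexMeas_isClosed_setOf_le_countP` — for closed `F` the superlevel set
   `{x | m ≤ #(roots of charpoly (A x) in F)}` is closed (upper semicontinuity of the count, i.e.
   continuity of the roots of a monic polynomial in its coefficients).  Along an ultrafilter `u`
   converging to `x` and containing the superlevel set, the root tuples `z(x') : Fin (card n) → ℂ`
   (`charpoly (A x') = ∏ᵢ (X − z(x')ᵢ)`, `ℂ` algebraically closed) are bounded by the entry sum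
   `∑ ‖A x' a b‖` (`indexMeas_norm_le_of_eval_charpoly`, an eigenvector row-sum estimate), hence
   converge along `u` to a tuple `w` (compactness of closed balls in `Fin N → ℂ`); the finite index set
   `{i | z(x')ᵢ ∈ F}` is `u`-eventually a constant `I₀` with `m ≤ |I₀|`, so `wᵢ ∈ F` for `i ∈ I₀`
   (`F` closed); and `charpoly (A x) = ∏ᵢ (X − wᵢ)` since both sides take the same value at every
   `c ∈ ℂ` (the `u`-limits of `det (c − A x') = ∏ᵢ (c − z(x')ᵢ)`; `Polynomial.funext`).
2. `indexMeas_le_countP_iff` — over a finite multiset, `m ≤ countP P ↔ ∃ j, m ≤ countP (· ∈ F j)`, so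
   the superlevel sets of the `P`-count are countable unions of closed sets, and an `ℕ`-valued map
   with measurable superlevel sets is measurable (`indexMeas_measurable_of_superlevel`).
3. The application: `U ↦ Γ₅ D_W(U, m₀, 1)` is continuous (`continuous_wilsonDirac` for the continuous
   fundamental representation, times the constant matrix `Γ₅ ⊗ 1`), and `{re < 0}` is exhausted by the
   closed half-planes `{re ≤ −1/(j+1)}`.

No new definitions; pure theorem file serving the lead's skeleton `work/WindowExtinction.lean`
(Mathlib only: `Matrix.eval_charpoly`, `Matrix.exists_mulVec_eq_zero_iff`, `IsAlgClosed.splits`,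
`Polynomial.roots_multiset_prod_X_sub_C`, `isClosed_iff_ultrafilter`,
`IsCompact.ultrafilter_le_nhds`, `Ultrafilter.eventually_exists_iff`).
-/

noncomputable section

namespace Summit.QuantumFields.QCD.Cruxes.WindowExtinction.WallConditionedCellSpread

open scoped BigOperators Topology Classical MeasureTheory Matrix ComplexConjugate
open Filter MeasureTheory Matrix
open Literature.MathematicalPhysics.QuantumLattice Literature.MathematicalPhysics.QuantumFieldTheory
  Literature.Probability.LatticeModels

/-! ## The general fact: semicontinuity and measurability of root counts
(adapted from `Theorems/SpectralDefectExtinctionTipPricingStubCountMeasurable.lean`) -/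

section General

open Polynomial

variable {n : Type*} [Fintype n] [DecidableEq n]

-- adapted from …StubCountMeasurable `countMeas_exists_tuple_of_card_eq`
/-- A multiset of cardinality `N` is the image of `Finset.univ : Finset (Fin N)` under a tuple. -/
theorem indexMeas_exists_tuple_of_card_eq {α : Type*} {N : ℕ} (s : Multiset α)
    (hs : N = Multiset.card s) :
    ∃ f : Fin N → α, (Finset.univ : Finset (Fin N)).val.map f = s := by
  subst hs
  induction s using Quotient.inductionOn with
  | h l =>
    refine ⟨fun i => l.get i, ?_⟩
    rw [Fin.univ_val_map]
    exact congrArg _ (List.ofFn_get l)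

-- adapted from …StubCountMeasurable `countMeas_countP_roots_prod`
/-- The number of roots in `F` of `∏ i, (X - C (w i))` is the number of indices `i` with
`w i ∈ F`. -/
theorem indexMeas_countP_roots_prod {ι : Type*} [Fintype ι] (w : ι → ℂ) (F : Set ℂ) :
    (∏ i, (X - C (w i))).roots.countP (· ∈ F) =
      (Finset.univ.filter fun i => w i ∈ F).card := by
  have h : (∏ i, (X - C (w i))) = ((Finset.univ.val.map w).map fun a => X - C a).prod := by
    rw [Multiset.map_map, Finset.prod_eq_multiset_prod]
    rfl
  rw [h, roots_multiset_prod_X_sub_C, Multiset.countP_map]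
  rfl

-- adapted from …StubCountMeasurable `countMeas_exists_charpoly_eq_prod`
/-- Over `ℂ` the characteristic polynomial of an `n × n` matrix is a product of `card n` linear
factors, indexed by `Fin (card n)`. -/
theorem indexMeas_exists_charpoly_eq_prod (M : Matrix n n ℂ) :
    ∃ μ : Fin (Fintype.card n) → ℂ, (∏ i, (X - C (μ i))) = M.charpoly := by
  have hsplit : M.charpoly.Splits := IsAlgClosed.splits M.charpoly
  have hcard : Fintype.card n = Multiset.card M.charpoly.roots := by
    rw [← Matrix.charpoly_natDegree_eq_dim M, hsplit.natDegree_eq_card_roots]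
  obtain ⟨μ, hμ⟩ := indexMeas_exists_tuple_of_card_eq _ hcard
  refine ⟨μ, ?_⟩
  have h : (∏ i, (X - C (μ i))) = ((Finset.univ.val.map μ).map fun a => X - C a).prod := by
    rw [Multiset.map_map, Finset.prod_eq_multiset_prod]
    rfl
  rw [h, hμ]
  exact (hsplit.eq_prod_roots_of_monic (Matrix.charpoly_monic M)).symm

-- adapted from …StubCountMeasurable `countMeas_norm_le_of_isRoot_charpoly`
/-- **Row-sum bound on the eigenvalues.** Every zero `μ` of the characteristic polynomial of a
complex matrix `M` satisfies `‖μ‖ ≤ ∑ i j, ‖M i j‖` (an eigenvector `v` with `Mv = μv` gives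
`|μ| ‖v‖_∞ ≤ (max row sum) ‖v‖_∞`). -/
theorem indexMeas_norm_le_of_eval_charpoly (M : Matrix n n ℂ) {μ : ℂ}
    (h : M.charpoly.eval μ = 0) : ‖μ‖ ≤ ∑ i, ∑ j, ‖M i j‖ := by
  have hdet : (Matrix.scalar n μ - M).det = 0 := by
    rw [← Matrix.eval_charpoly]
    exact h
  obtain ⟨v, hv0, hv⟩ := Matrix.exists_mulVec_eq_zero_iff.mpr hdet
  obtain ⟨i₁, hi₁⟩ : ∃ i, v i ≠ 0 := by
    by_contra hall
    push Not at hall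
    exact hv0 (funext hall)
  obtain ⟨i₀, -, hi₀⟩ :=
    Finset.exists_max_image Finset.univ (fun i => ‖v i‖) ⟨i₁, Finset.mem_univ i₁⟩
  have hpos : 0 < ‖v i₀‖ := (norm_pos_iff.mpr hi₁).trans_le (hi₀ i₁ (Finset.mem_univ i₁))
  have hrow : μ * v i₀ = (M *ᵥ v) i₀ := by
    have := congrFun hv i₀
    rwa [Matrix.sub_mulVec, Pi.sub_apply, Pi.zero_apply, Matrix.scalar_apply,
      Matrix.mulVec_diagonal, sub_eq_zero] at this
  have key : ‖μ‖ * ‖v i₀‖ ≤ (∑ j, ‖M i₀ j‖) * ‖v i₀‖ := by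
    calc ‖μ‖ * ‖v i₀‖ = ‖(M *ᵥ v) i₀‖ := by rw [← norm_mul, hrow]
      _ = ‖∑ j, M i₀ j * v j‖ := rfl
      _ ≤ ∑ j, ‖M i₀ j * v j‖ := norm_sum_le _ _
      _ ≤ ∑ j, ‖M i₀ j‖ * ‖v i₀‖ := Finset.sum_le_sum fun j _ => by
          rw [norm_mul]
          exact mul_le_mul_of_nonneg_left (hi₀ j (Finset.mem_univ j)) (norm_nonneg _)
      _ = (∑ j, ‖M i₀ j‖) * ‖v i₀‖ := (Finset.sum_mul _ _ _).symm
  have h1 : ‖μ‖ ≤ ∑ j, ‖M i₀ j‖ := le_of_mul_le_mul_right key hpos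
  exact h1.trans (Finset.single_le_sum (f := fun i => ∑ j, ‖M i j‖)
    (fun i _ => Finset.sum_nonneg fun j _ => norm_nonneg _) (Finset.mem_univ i₀))

-- adapted from …StubCountMeasurable `countMeas_isClosed_setOf_le_countP`
/-- **Upper semicontinuity of the root count in a closed set.** For a continuous matrix-valued map
`A` on a topological space `T` and a closed `F ⊆ ℂ`, the set of `x` at which the characteristic
polynomial of `A x` has at least `m` roots in `F` (with multiplicity) is closed.  Proof: along an
ultrafilter converging to `x` the root tuples are bounded, hence converge along the ultrafilter to
a tuple `w`; the index set of roots in `F` is eventually constant (`= I₀`, `m ≤ |I₀|`), so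
`w i ∈ F` for `i ∈ I₀`; and `charpoly (A x) = ∏ (X - w i)` because both sides have the same values
(limits of `det (c - A x') = ∏ (c - z_i(x'))`). -/
theorem indexMeas_isClosed_setOf_le_countP {T : Type*} [TopologicalSpace T]
    {A : T → Matrix n n ℂ} (hA : Continuous A) (m : ℕ) {F : Set ℂ} (hF : IsClosed F) :
    IsClosed {x | m ≤ (A x).charpoly.roots.countP (· ∈ F)} := by
  choose z hz using fun x => indexMeas_exists_charpoly_eq_prod (A x)
  have hcount : ∀ x, (A x).charpoly.roots.countP (· ∈ F) =
      (Finset.univ.filter fun i => z x i ∈ F).card := fun x => by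
    rw [← hz x, indexMeas_countP_roots_prod]
  have heval : ∀ x c, (A x).charpoly.eval c = ∏ i, (c - z x i) := fun x c => by
    rw [← hz x, eval_prod]
    simp only [eval_sub, eval_X, eval_C]
  have hbound : ∀ x i, ‖z x i‖ ≤ ∑ a, ∑ b, ‖A x a b‖ := fun x i => by
    refine indexMeas_norm_le_of_eval_charpoly (A x) ?_
    rw [heval]
    exact Finset.prod_eq_zero (Finset.mem_univ i) (sub_self _)
  rw [isClosed_iff_ultrafilter]
  intro x u hux hxu
  -- the index set of the roots lying in `F` is constant along `u`
  obtain ⟨I₀, hI₀⟩ : ∃ I₀ : Finset (Fin (Fintype.card n)),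
      ∀ᶠ x' in (u : Filter T), (Finset.univ.filter fun i => z x' i ∈ F) = I₀ :=
    Ultrafilter.eventually_exists_iff.mp (Eventually.of_forall fun x' => ⟨_, rfl⟩)
  have hm : m ≤ I₀.card := by
    obtain ⟨x', h1, h2⟩ := (hI₀.and hxu).exists
    rw [← h1, ← hcount]
    exact h2
  -- the root tuples are bounded along `u`, hence converge along `u`
  set R : ℝ := (∑ a, ∑ b, ‖A x a b‖) + 1 with hR
  have hBcont : Continuous fun x' => ∑ a, ∑ b, ‖A x' a b‖ :=
    continuous_finsetSum _ fun a _ => continuous_finsetSum _ fun b _ => (hA.matrix_elem a b).norm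
  have hR0 : 0 ≤ R := add_nonneg (Finset.sum_nonneg fun a _ => Finset.sum_nonneg fun b _ =>
    norm_nonneg _) zero_le_one
  have hball : ∀ᶠ x' in (u : Filter T),
      z x' ∈ Metric.closedBall (0 : Fin (Fintype.card n) → ℂ) R := by
    have h1 : ∀ᶠ x' in 𝓝 x, (∑ a, ∑ b, ‖A x' a b‖) < R :=
      (hBcont.tendsto x).eventually (gt_mem_nhds (lt_add_one _))
    refine (h1.filter_mono hux).mono fun x' hx' => ?_
    rw [mem_closedBall_zero_iff]
    exact (pi_norm_le_iff_of_nonneg hR0).mpr fun i => (hbound x' i).trans hx'.le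
  have hle : (u.map z : Filter (Fin (Fintype.card n) → ℂ)) ≤
      𝓟 (Metric.closedBall (0 : Fin (Fintype.card n) → ℂ) R) := by
    rw [Ultrafilter.coe_map, le_principal_iff]
    exact hball
  obtain ⟨w, -, hw⟩ := (isCompact_closedBall _ R).ultrafilter_le_nhds (u.map z) hle
  have hzw : Tendsto z (u : Filter T) (𝓝 w) := by
    rw [Tendsto, ← Ultrafilter.coe_map]
    exact hw
  have hzwi : ∀ i, Tendsto (fun x' => z x' i) (u : Filter T) (𝓝 (w i)) := fun i =>
    ((continuous_apply i).tendsto w).comp hzw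
  -- the limit tuple has its `I₀`-entries in `F`
  have hwF : ∀ i ∈ I₀, w i ∈ F := fun i hi =>
    hF.mem_of_tendsto (hzwi i) (hI₀.mono fun x' hx' => by
      have : i ∈ Finset.univ.filter fun j => z x' j ∈ F := hx' ▸ hi
      exact (Finset.mem_filter.mp this).2)
  -- and it is a root tuple of `charpoly (A x)`
  have hlim : (A x).charpoly = ∏ i, (X - C (w i)) := by
    refine Polynomial.funext fun c => ?_
    have h1 : Tendsto (fun x' => (A x').charpoly.eval c) (u : Filter T)
        (𝓝 ((A x).charpoly.eval c)) := by
      simp_rw [Matrix.eval_charpoly]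
      exact ((continuous_const.sub hA).matrix_det.tendsto x).mono_left hux
    have h2 : Tendsto (fun x' => (A x').charpoly.eval c) (u : Filter T)
        (𝓝 (∏ i, (c - w i))) := by
      simp_rw [heval]
      exact tendsto_finsetProd _ fun i _ => tendsto_const_nhds.sub (hzwi i)
    rw [tendsto_nhds_unique h1 h2, eval_prod]
    simp only [eval_sub, eval_X, eval_C]
  show m ≤ _
  rw [hlim, indexMeas_countP_roots_prod]
  exact hm.trans (Finset.card_le_card fun i hi =>
    Finset.mem_filter.mpr ⟨Finset.mem_univ _, hwF i hi⟩)

-- adapted from …StubCountMeasurable `countMeas_measurable_of_superlevel`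
/-- An `ℕ`-valued function with measurable superlevel sets `f ⁻¹' [m, ∞)` is measurable. -/
theorem indexMeas_measurable_of_superlevel {T : Type*} [MeasurableSpace T] {f : T → ℕ}
    (hf : ∀ m : ℕ, MeasurableSet (f ⁻¹' Set.Ici m)) : Measurable f := by
  refine measurable_to_countable' fun m => ?_
  have : f ⁻¹' {m} = f ⁻¹' Set.Ici m \ f ⁻¹' Set.Ici (m + 1) := by
    ext x
    simp only [Set.mem_preimage, Set.mem_singleton_iff, Set.mem_sdiff, Set.mem_Ici]
    omega
  rw [this]
  exact (hf m).diff (hf (m + 1))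

-- adapted from …StubCountMeasurable `countMeas_le_countP_iff`
/-- Counting in an increasing countable union `{P} = ⋃ⱼ F j` over a (finite) multiset: at least
`m` elements satisfy `P` iff at least `m` elements lie in some `F j`. -/
theorem indexMeas_le_countP_iff {α : Type*} (m : ℕ) (s : Multiset α) (P : α → Prop)
    [DecidablePred P] (F : ℕ → Set α) (hmono : Monotone F) (hPF : ∀ a, P a ↔ ∃ j, a ∈ F j) :
    m ≤ s.countP P ↔ ∃ j, m ≤ s.countP (· ∈ F j) := by
  have hJ : ∃ J, ∀ a ∈ s, P a → a ∈ F J := by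
    induction s using Multiset.induction_on with
    | empty => exact ⟨0, fun a ha _ => absurd ha (Multiset.notMem_zero a)⟩
    | cons b s ih =>
      obtain ⟨J₀, hJ₀⟩ := ih
      by_cases hb : P b
      · obtain ⟨j, hj⟩ := (hPF b).mp hb
        refine ⟨max J₀ j, fun a ha hPa => ?_⟩
        rcases Multiset.mem_cons.mp ha with rfl | ha
        · exact hmono (le_max_right _ _) hj
        · exact hmono (le_max_left _ _) (hJ₀ a ha hPa)
      · refine ⟨J₀, fun a ha hPa => ?_⟩
        rcases Multiset.mem_cons.mp ha with rfl | ha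
        · exact absurd hPa hb
        · exact hJ₀ a ha hPa
  obtain ⟨J, hJ⟩ := hJ
  constructor
  · intro hm
    exact ⟨J, hm.trans_eq (Multiset.countP_congr rfl fun a ha =>
      propext ⟨hJ a ha, fun h => (hPF a).mpr ⟨J, h⟩⟩)⟩
  · rintro ⟨j, hj⟩
    refine hj.trans ?_
    rw [Multiset.countP_eq_card_filter, Multiset.countP_eq_card_filter]
    exact Multiset.card_le_card (Multiset.monotone_filter_right s fun a ha => (hPF a).mpr ⟨j, ha⟩)

-- adapted from …StubCountMeasurable `countMeas_measurable_countP`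
/-- **Measurability of spectral counts.** For a continuous matrix-valued map `A` on a topological
space with a measurable structure containing the open sets, and a predicate `P` on `ℂ` whose truth
set is an increasing countable union of closed sets `F j`, `x ↦ #{roots of charpoly (A x) satisfying P}`
(with multiplicity) is measurable: its superlevel sets are countable unions of closed sets. -/
theorem indexMeas_measurable_countP {T : Type*} [TopologicalSpace T] [MeasurableSpace T]
    [OpensMeasurableSpace T] {A : T → Matrix n n ℂ} (hA : Continuous A) (F : ℕ → Set ℂ)
    (hF : ∀ j, IsClosed (F j)) (hmono : Monotone F) (P : ℂ → Prop) [DecidablePred P]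
    (hPF : ∀ a, P a ↔ ∃ j, a ∈ F j) :
    Measurable fun x => (A x).charpoly.roots.countP P := by
  refine indexMeas_measurable_of_superlevel fun m => ?_
  have : (fun x => (A x).charpoly.roots.countP P) ⁻¹' Set.Ici m =
      ⋃ j, {x | m ≤ (A x).charpoly.roots.countP (· ∈ F j)} := by
    ext x
    simp only [Set.mem_preimage, Set.mem_Ici, Set.mem_setOf_eq, Set.mem_iUnion]
    exact indexMeas_le_countP_iff m _ P F hmono hPF
  rw [this]
  exact MeasurableSet.iUnion fun j =>
    (indexMeas_isClosed_setOf_le_countP hA m (hF j)).measurableSet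

end General

/-! ## The spectral index of the Hermitian Wilson–Dirac operator
(adapted from `Theorems/SpectralDefectExtinctionWindowExtinctionStubNegCountMeasurable.lean`) -/

/-- **STUB S7 · `stub_indexMeasurable`** — for every torus side `n` and bare mass `m₀`, the number of
roots `z` with `re z < 0` (with multiplicity) of the characteristic polynomial of the Hermitian
Wilson–Dirac operator `Γ₅ D_W(U, m₀, 1)` (`SU(3)`, fundamental representation, `r = 1`) is a Borel
measurable function of the gauge field `U`. -/
theorem stub_indexMeasurable :
    ∀ (n : ℕ) [NeZero n] (m₀ : ℝ), Measurable fun U : GaugeConfig 4 n (Matrix.specialUnitaryGroup (Fin 3) ℂ) =>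
      (spinorLift gammaFive * wilsonDirac (fundamentalRep (Fin 3)) U m₀ 1).charpoly.roots.countP
        fun z : ℂ => z.re < 0 := by
  intro n _ m₀
  -- `U ↦ Γ₅ D_W(U, m₀, 1)` is continuous in the gauge field
  have hA : Continuous fun U : GaugeConfig 4 n (Matrix.specialUnitaryGroup (Fin 3) ℂ) =>
      spinorLift gammaFive * wilsonDirac (fundamentalRep (Fin 3)) U m₀ 1 :=
    continuous_const.matrix_mul
      (continuous_wilsonDirac _ (continuous_fundamentalRep (Fin 3)) m₀ 1)
  -- `{re < 0}` is exhausted by the closed half-planes `{re ≤ -1/(j+1)}`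
  refine indexMeas_measurable_countP hA (fun j => {z : ℂ | z.re ≤ -(1 / ((j : ℝ) + 1))})
    (fun j => ?_) (fun j k hjk => ?_) (fun z : ℂ => z.re < 0) (fun z => ?_)
  · exact isClosed_le Complex.continuous_re continuous_const
  · intro z hz
    simp only [Set.mem_setOf_eq] at hz ⊢
    have : (1 : ℝ) / (k + 1) ≤ 1 / (j + 1) :=
      one_div_le_one_div_of_le (by positivity) (by exact_mod_cast Nat.succ_le_succ hjk)
    linarith
  · constructor
    · intro h
      obtain ⟨j, hj⟩ := exists_nat_one_div_lt (neg_pos.mpr h)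
      exact ⟨j, by simp only [Set.mem_setOf_eq]; linarith⟩
    · rintro ⟨j, hj⟩
      simp only [Set.mem_setOf_eq] at hj
      have : (0 : ℝ) < 1 / (j + 1) := by positivity
      linarith

end Summit.QuantumFields.QCD.Cruxes.WindowExtinction.WallConditionedCellSpread

end
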